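import Summits.CriticalPhenomena.PercolationContinuityZ3.Theses.PercVarianceSandwich
import Summits.CriticalPhenomena.PercolationContinuityZ3.Theorems.PercNearOneGluingNoHeavyLowerTailCSHTheoremOne
import HarnessLib

/-!
# `PercVarianceSandwich.TargetOfCruxes` (stmt-CriticalPhenomena-14185) — SETTLED after continuity

Item `stmt-CriticalPhenomena-14185` of route `CriticalPhenomena/PercVarianceSandwich` (support (glue)): `CritBlockingNotSuperpolynomial → FiniteClusterMomentsOfTheta → Target`.

The target is literally the conjunction of the two crux bodies: `And.intro`.  p205010 is NOT used.

builds on p205010 (kernel theorem, internal audit signed; external expert review pending) — USED (`CSH.percolationContinuityZ3_holds`).  RSW3 lane, lead gen 28 (prover-prim-rsw3-lead-g28-0):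
'after continuity — the ledger harvest'.
References: G. Kozma, N. Nitzan (2024), Thm. 6 / Conj. 3 [KozmaNitzan2024]; G. Grimmett, *Percolation* (1999), §8 [GrimmettPercolation1999].
-/

noncomputable section

namespace Summit.CriticalPhenomena.PercolationContinuityZ3.Theorems

namespace PercVarianceSandwichTargetOfCruxes

open MeasureTheory Literature.Probability.Percolation Literature.Probability.LatticeModels

/-- **`PercVarianceSandwich.TargetOfCruxes` (stmt-CriticalPhenomena-14185), settled.**  `fun hA hB => ⟨hA, hB⟩`.
[cite: KozmaNitzan2024, Thm. 6 with Conj. 3 (p. 15)] -/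
theorem targetOfCruxes_proof : Summit.CriticalPhenomena.PercolationContinuityZ3.Theses.PercVarianceSandwich.TargetOfCruxes := by
  unfold Summit.CriticalPhenomena.PercolationContinuityZ3.Theses.PercVarianceSandwich.TargetOfCruxes
  intro hA hB
  exact ⟨hA, hB⟩

end PercVarianceSandwichTargetOfCruxes

end Summit.CriticalPhenomena.PercolationContinuityZ3.Theorems

end
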